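import Summits.HodgeConjecture.CorCM.MultiFieldWeilJointlyOntoBlocks
import Summits.HodgeConjecture.CorCM.IrreducibleOddWeightsHodgeGluingBlocks
import Literature.AlgebraicGeometry.Pohlmann1968.SimpleCMAbelianVarietyHazamaCriterion
import HarnessLib

/-!
# MULTI-FIELD WEIL ENGINE — HODGE GLUING ALONG BLOCKS WITH NONDEGENERATE EXCEPTIONAL SETS: the CM dress of `CorCM/MultiFieldWeilJointlyOntoBlocks.lean`

Cell `pub-hodgecm2` (COR-CM), seat b30 gen 36 (2026-08-25); count-neutral own lane MULTI-FIELD WEIL ENGINE (stem `MultiFieldWeil*`).  Theorems only; no definition, no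
named fact, no `sorry`.  HONEST FRAMING: an UNCONDITIONAL reduction between instances of the Hodge conjecture for CM abelian varieties (the Hodge conjecture inside the
blocks is a HYPOTHESIS); `HC_CM` is neither used nor asserted.  Support version of `CorCM/MultiFieldWeilPairAdditiveGluing.lean`:

* `jointlyOnto_of_typeRank_subtype_eq` (abstract) — a NONDEGENERATE sub-family on a finite set `J` of slots is jointly onto in `U(Σ)`;
* **`cmFamilyRank_add_card_eq_of_nondegenerate_sets_fiber`** — `κ : I ↠ D`; if every finite set `J` of slots meeting two blocks, in which every two distinct slots share a
  constituent (p2's «pairwise» predicate fails in both orders), has a NONDEGENERATE sub-family `(Φ_l)_{l ∈ J}`, then `cmFamilyRank Φ + |D| = Σ_d cmFamilyRank Φ|_{κ = d} + 1`;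
* **`hodgeConjectureFor_prod_of_blocks_of_nondegenerate_sets`** — then the Hodge conjecture for the products of copies inside each block implies it for every product of
  copies; dominated form.
Intended consumer (successor): blocks = k-groups ∪ their curves, SINGLETON no-k threefolds, the surface block; the sets `J` handed over are sets of sextic slots with one Galois
closure, pairwise not sharing, at most one per k-group — nondegenerate by seat b16's census when at most THREE of them have isomorphic fields.

[cite: MoonenZarhin1999LowDim, §3 (3.1), Remark (3.9)] [cite: Gordon1999HodgeAVSurvey, §3 Theorem (Imai, Murty) with proof, 7.5–7.7] [cite: Deligne1982HodgeCycles, I Ex. 3.7 (c)]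
[cite: MumfordAV1970, §19 Thm. 1 and p. 169]
-/

noncomputable section

open scoped BigOperators

open CategoryTheory CategoryTheory.Limits NumberField IntermediateField

namespace Summit.HodgeConjecture.CorCM.MultiFieldWeil

open Literature.NumberTheory.ComplexMultiplication
open Literature.AlgebraicGeometry Literature.AlgebraicGeometry.Motives Literature.AlgebraicGeometry.HodgeTheory
open Literature.AlgebraicGeometry.ComplexMultiplication (IsCMTypeRealisation)
open Literature.AlgebraicTopology.SingularHomology
open Literature.AlgebraicGeometry.Pohlmann1968

open scoped Classical

/-! ## §0 A nondegenerate sub-family on a finite set of slots is jointly onto (abstract) -/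

section Abstract

universe u v w

variable {G : Type w} [Group G] {I : Type u} {E : I → Type v} [∀ i, MulAction G (E i)] [DecidableEq I] [∀ i, Fintype (E i)] [∀ i, Nonempty (E i)]

/-- **A NONDEGENERATE SUB-FAMILY IS JOINTLY ONTO**: if the sub-family on the finite set `J` of slots has maximal rank, every tuple `(a_i ∈ U(Φ_i))_{i ∈ J}` is the tuple of
restrictions of one `m ∈ U(Σ)`. [cite: Gordon1999HodgeAVSurvey, 7.5–7.6] -/
theorem jointlyOnto_of_typeRank_subtype_eq {ρ : G} {Φ : ∀ i, Set (E i)} (h : ∀ i, IsCMTypeWith ρ (Φ i)) (J : Finset I) (hJ : J.Nonempty)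
    (hnd : typeRank G (sigmaType fun l : {l // l ∈ J} => Φ l.1) = Fintype.card (Σ l : {l // l ∈ J}, E l.1) / 2 + 1)
    (a : ∀ i, E i → ℚ) (ha : ∀ i ∈ J, a i ∈ antiSpan G (Φ i)) :
    ∃ m ∈ antiSpan G (sigmaType Φ), ∀ i ∈ J, LinearMap.funLeft ℚ ℚ (Sigma.mk i) m = a i := by
  classical
  obtain ⟨i₀, hi₀⟩ := hJ
  haveI : Nonempty {l // l ∈ J} := ⟨⟨i₀, hi₀⟩⟩
  have hadd := forall_map_slotExt_le_of_typeRank_sigmaType_eq (G := G) (Φ := fun l : {l // l ∈ J} => Φ l.1) (fun l => h l.1) hnd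
  have hw : (∑ l : {l // l ∈ J}, slotExt l (a l.1)) ∈ antiSpan G (sigmaType fun l : {l // l ∈ J} => Φ l.1) :=
    Submodule.sum_mem _ fun l _ => hadd l ⟨a l.1, ha l.1 l.2, rfl⟩
  rw [← map_funLeft_subtype_antiSpan_sigmaType Φ (fun l => l ∈ J)] at hw
  obtain ⟨m, hm, hmw⟩ := hw
  refine ⟨m, hm, fun i hi => ?_⟩
  funext s
  have e := congrFun hmw ⟨⟨i, hi⟩, s⟩
  rw [LinearMap.funLeft_apply] at e
  rw [LinearMap.funLeft_apply, e, Finset.sum_apply, Finset.sum_eq_single (⟨i, hi⟩ : {l // l ∈ J})]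
  · rw [slotExt_apply_same]
  · intro l _ hl
    exact slotExt_apply_of_ne (Ne.symm hl) _ _
  · intro hni
    exact absurd (Finset.mem_univ _) hni

end Abstract

variable {I : Type} [Fintype I] {K : I → Type} [∀ i, Field (K i)] [∀ i, NumberField (K i)] [∀ i, IsCMField (K i)]
  {D : Type} [Fintype D]

/-! ## §1 The CM dress of the rank identity -/

omit [∀ i, IsCMField (K i)] in
/-- `|⊔_i Hom(K_i, ℂ)| = Σ_i [K_i : ℚ]`. [folklore] -/
private theorem card_sigma_ringHom_eq_sum_finrank₃₆s {J : Type} [Fintype J] (L : J → Type) [∀ j, Field (L j)] [∀ j, NumberField (L j)] :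
    Fintype.card ((j : J) × (L j →+* ℂ)) = ∑ j, Module.finrank ℚ (L j) := by
  rw [Fintype.card_sigma]
  exact Finset.sum_congr rfl fun j _ => Embeddings.card (L j) ℂ

/-- **RANK ADDITIVITY OVER THE BLOCKS, WITH NONDEGENERATE EXCEPTIONAL SETS (CM fields).**  `κ : I ↠ D`; every finite set `J` of slots meeting two blocks in which every two
distinct slots share a constituent carries a nondegenerate sub-family.  Then `rank((Φ_i)_i) + |D| = Σ_d rank((Φ_i)_{κ i = d}) + 1` — `Hg(∏_i A_i) = ∏_d Hg(∏_{κ i = d} A_i)`.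
[cite: MoonenZarhin1999LowDim, §3 (3.1), Remark (3.9)] [cite: Gordon1999HodgeAVSurvey, §3 Theorem (1) (proof)] -/
theorem cmFamilyRank_add_card_eq_of_nondegenerate_sets_fiber [Nonempty I] (Φ : ∀ i, CMType (K i)) (κ : I → D) (hκ : Function.Surjective κ)
    (hyp : ∀ J : Finset I, (∃ i ∈ J, ∃ j ∈ J, κ i ≠ κ j) →
      (∀ i ∈ J, ∀ j ∈ J, i ≠ j → ¬ (∀ P : Submodule ℚ ((K i →+* ℂ) → ℚ), P ≤ antiSpan (ℂ ≃+* ℂ) (Φ i).1 → (∀ g : ℂ ≃+* ℂ, ∀ f ∈ P, (fun x => f (g • x)) ∈ P) →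
          ∀ T : ((K i →+* ℂ) → ℚ) →ₗ[ℚ] ((K j →+* ℂ) → ℚ), (∀ g : ℂ ≃+* ℂ, ∀ f ∈ P, T (fun x => f (g • x)) = fun y => T f (g • y)) →
            (∀ f ∈ P, T f ∈ antiSpan (ℂ ≃+* ℂ) (Φ j).1) → (∀ f ∈ P, T f = 0 → f = 0) → P = ⊥)) →
      CMAlgebra.IsNondegenerateFamily (fun l : {l : I // l ∈ J} => Φ l.1)) :
    CMAlgebra.cmFamilyRank Φ + Fintype.card D = (∑ d, CMAlgebra.cmFamilyRank fun i : {i : I // κ i = d} => Φ i.1) + 1 := by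
  classical
  refine typeRank_sigmaType_add_card_eq_of_jointlyOnto_sets_fiber (G := ℂ ≃+* ℂ) (Φ := fun i => (Φ i).1) (fun i => isCMTypeWith_conj (Φ i)) κ hκ
    fun J hJ2 hsh a ha => ?_
  have hJ : J.Nonempty := by obtain ⟨i, hi, -⟩ := hJ2; exact ⟨i, hi⟩
  have hnd := hyp J hJ2 hsh
  have hnd' : typeRank (ℂ ≃+* ℂ) (sigmaType fun l : {l : I // l ∈ J} => (Φ l.1).1) = Fintype.card ((l : {l : I // l ∈ J}) × (K l.1 →+* ℂ)) / 2 + 1 := by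
    rw [card_sigma_ringHom_eq_sum_finrank₃₆s (fun l : {l : I // l ∈ J} => K l.1)]
    exact hnd
  exact jointlyOnto_of_typeRank_subtype_eq (G := ℂ ≃+* ℂ) (Φ := fun i => (Φ i).1) (fun i => isCMTypeWith_conj (Φ i)) J hJ hnd' a ha

/-! ## §2 The Hodge conjecture glues along such blocks -/

variable {Φ : ∀ i, CMType (K i)} {A : I → AbelianVariety ℂ} {ι : ∀ i, 𝓞 (K i) →+* End (A i)} {θ : ∀ i, K i →+* Module.End ℂ (complexBetti (A i).X 1)}

/-- **HODGE GLUING ALONG BLOCKS WITH NONDEGENERATE EXCEPTIONAL SETS.**  `A_i ⊨ (K_i; Φ_i)` (`i ∈ I` finite), `κ : I ↠ D` as in §1.  IF the Hodge conjecture holds for every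
product of copies of members of each single block, THEN it holds for EVERY product of copies `⨁_j A_{π j}` — UNCONDITIONALLY. [cite: MoonenZarhin1999LowDim, §3 (3.1)]
[cite: Gordon1999HodgeAVSurvey, §3 Theorem (Imai, Murty) with proof, 7.5–7.7] -/
theorem hodgeConjectureFor_prod_of_blocks_of_nondegenerate_sets (hA : ∀ i, IsCMTypeRealisation (Φ i) (A i) (ι i) (θ i)) (κ : I → D) (hκ : Function.Surjective κ)
    (hyp : ∀ J : Finset I, (∃ i ∈ J, ∃ j ∈ J, κ i ≠ κ j) →
      (∀ i ∈ J, ∀ j ∈ J, i ≠ j → ¬ (∀ P : Submodule ℚ ((K i →+* ℂ) → ℚ), P ≤ antiSpan (ℂ ≃+* ℂ) (Φ i).1 → (∀ g : ℂ ≃+* ℂ, ∀ f ∈ P, (fun x => f (g • x)) ∈ P) →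
          ∀ T : ((K i →+* ℂ) → ℚ) →ₗ[ℚ] ((K j →+* ℂ) → ℚ), (∀ g : ℂ ≃+* ℂ, ∀ f ∈ P, T (fun x => f (g • x)) = fun y => T f (g • y)) →
            (∀ f ∈ P, T f ∈ antiSpan (ℂ ≃+* ℂ) (Φ j).1) → (∀ f ∈ P, T f = 0 → f = 0) → P = ⊥)) →
      CMAlgebra.IsNondegenerateFamily (fun l : {l : I // l ∈ J} => Φ l.1))
    (hHC : ∀ (d : D) (M : ℕ) (ρ : Fin M → I), (∀ l, κ (ρ l) = d) → HodgeConjectureFor (⨁ fun l => A (ρ l)).dim (⨁ fun l => A (ρ l)).X)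
    {N : ℕ} (π : Fin N → I) : HodgeConjectureFor (⨁ fun j => A (π j)).dim (⨁ fun j => A (π j)).X := by
  cases N with
  | zero => exact hodgeConjectureFor_of_isDivisorGenerated _ (isDivisorGenerated_of_dim_eq_zero _ (dim_biproduct_fin_zero _))
  | succ N =>
    haveI : Nonempty I := ⟨π 0⟩
    refine hodgeConjectureFor_biproduct_of_cmFamilyRank_fiber_add_card_eq κ hκ
      (cmFamilyRank_add_card_eq_of_nondegenerate_sets_fiber Φ κ hκ hyp) hA (fun d J _ _ π' => ?_) π
    let ε : Fin (Fintype.card J) ≃ J := (Fintype.equivFin J).symm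
    have hdom : Domination.AVDominatedBy (⨁ fun j => A (π' j).1) (⨁ fun l => A (π' (ε l)).1) :=
      Domination.AVDominatedBy.of_iso (biproduct.reindex ε fun j => A (π' j).1).symm (Domination.AVDominatedBy.refl _)
    exact Domination.hodgeConjectureFor_of_avDominatedBy (hHC d _ (fun l => (π' (ε l)).1) fun l => (π' (ε l)).2) hdom

/-- **Dominated form.** [cite: MoonenZarhin1999LowDim, §3 (3.1)] [cite: MumfordAV1970, §19 Thm. 1 and p. 169] -/
theorem hodgeConjectureFor_of_avDominatedBy_prod_of_blocks_of_nondegenerate_sets (hA : ∀ i, IsCMTypeRealisation (Φ i) (A i) (ι i) (θ i)) (κ : I → D)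
    (hκ : Function.Surjective κ)
    (hyp : ∀ J : Finset I, (∃ i ∈ J, ∃ j ∈ J, κ i ≠ κ j) →
      (∀ i ∈ J, ∀ j ∈ J, i ≠ j → ¬ (∀ P : Submodule ℚ ((K i →+* ℂ) → ℚ), P ≤ antiSpan (ℂ ≃+* ℂ) (Φ i).1 → (∀ g : ℂ ≃+* ℂ, ∀ f ∈ P, (fun x => f (g • x)) ∈ P) →
          ∀ T : ((K i →+* ℂ) → ℚ) →ₗ[ℚ] ((K j →+* ℂ) → ℚ), (∀ g : ℂ ≃+* ℂ, ∀ f ∈ P, T (fun x => f (g • x)) = fun y => T f (g • y)) →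
            (∀ f ∈ P, T f ∈ antiSpan (ℂ ≃+* ℂ) (Φ j).1) → (∀ f ∈ P, T f = 0 → f = 0) → P = ⊥)) →
      CMAlgebra.IsNondegenerateFamily (fun l : {l : I // l ∈ J} => Φ l.1))
    (hHC : ∀ (d : D) (M : ℕ) (ρ : Fin M → I), (∀ l, κ (ρ l) = d) → HodgeConjectureFor (⨁ fun l => A (ρ l)).dim (⨁ fun l => A (ρ l)).X)
    {N : ℕ} (π : Fin N → I) {X : AbelianVariety ℂ} (hX : Domination.AVDominatedBy X (⨁ fun j => A (π j))) : HodgeConjectureFor X.dim X.X :=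
  Domination.hodgeConjectureFor_of_avDominatedBy (hodgeConjectureFor_prod_of_blocks_of_nondegenerate_sets hA κ hκ hyp hHC π) hX

end Summit.HodgeConjecture.CorCM.MultiFieldWeil

end
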